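import Literature.IUT.HodgeArakelov.KummerStructures
import Mathlib.Algebra.BigOperators.Group.Finset.Basic
import HarnessLib

/-!
# [IUTchII] Example 1.8 (iv) / Definition 4.9 (i): a `G`-isometry of `O^{×μ}` preserves every NORM LATTICE

S. Mochizuki, *Inter-universal Teichmüller theory II*, §1 Example 1.8 (iv), kurims manuscript (Dec. 2020)
p. 39 [claim: Mochizuki2012, status: disputed] (IUTchII §1 Ex 1.8 (iv), kurims p.39): "`Ism(G)` … the compact
topological group of `G`-isometries of `O^{×μ}(G)`, i.e., `G`-equivariant automorphisms of the ind-topological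
module `O^{×μ}(G)` that, for each open subgroup `H ⊆ G`, preserve the lattice in `O^{×μ}(G)^H` determined by
the image of `O^×(G)^H`"; §4 Definition 4.9 (i) p. 154 (the same notion for the unit quotients of a
Frobenioid).  abc-iut-L6-t2 typed `Ism` as `isometryGroup ρ 𝓗` (`KummerStructures.lean`): the
`G`-equivariant automorphisms `φ` of `U^{×μ} = U ⧸ U^μ` with `φ(Im(U^H)) = Im(U^H)` for every `H ∈ 𝓗`.

THIS FILE (abc-iut cell, Cor. 3.12 sub-crew seat abc-iut-c312-1, gen 7; support lemma for the typed
[IUTchIII] Thm. 3.11 (i) (Ind2) at the real log-shells) records the one consequence of the DEFINITION that the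
cell's adjudication needs and nobody had typed — an elementary computation, no claim of the disputed corpus:

* `normMap ρ T` — the "norm" `x ↦ ∏_{t ∈ T} ρ(t)(x)` along a finite family `T ⊆ G` (for `T` a set of
  representatives of `G/H`, `H` normal of finite index, and `x ∈ U^H` this is the usual norm `N_{G/H}`);
* `normLattice ρ H T := Im(N_T(U^H)) ⊆ U^{×μ}` — the NORM LATTICE of `H` along `T`;
* **`map_normLattice_eq_of_mem_isometryGroup`**: every `φ ∈ Ism = isometryGroup ρ 𝓗` carries `normLattice ρ H T`
  ONTO itself, for every `H ∈ 𝓗` and EVERY finite `T` — because `φ` commutes with each `ρ(t)` on `U^{×μ}` and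
  carries `Im(U^H)` onto itself.  (With `U = 𝒪_k̄^×`, `G = G_k`, `H = G_E` for a finite Galois `E/k` and `T`
  lifts of `Gal(E/k)`: an isometry preserves `Im(N_{E/k}(𝒪_E^×)) ⊆ Im(𝒪_k^×)` — the input of the
  "isometries are scalars on the base" theorem of `Summits/ABC/IUTFork/Thm311RealInd2Ism*`.)

HONEST FRAMING: group theory about a DEFINITION of the disputed corpus; nothing here bears on [IUTchIII]
Cor. 3.12; no side taken.
-/

set_option autoImplicit false

namespace Literature.IUT.HodgeArakelov

universe u v

variable {G : Type u} [Group G] {U : Type v} [CommGroup U]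

/-! ## The norm along a finite family and the norm lattice -/

/-- The NORM along a finite family `T ⊆ G`: `N_T(x) = ∏_{t ∈ T} ρ(t)(x)` — a homomorphism since `U` is
commutative (for `T` a set of coset representatives of a normal finite-index `H` and `x ∈ U^H` this is the norm
`N_{G/H}(x)`; e.g. `N_{E/k}` on `𝒪_E^×` for `U = 𝒪_k̄^×`). [folklore] -/
noncomputable def normMap (ρ : G →* MulAut U) (T : Finset G) : U →* U where
  toFun x := ∏ t ∈ T, ρ t x
  map_one' := by simp
  map_mul' x y := by
    simp only [map_mul]
    exact Finset.prod_mul_distrib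

/-- Unfolding `normMap`: `N_T(x) = ∏_{t ∈ T} ρ(t)(x)`. [cite: Mochizuki2012, Def 4.9 (i) p.154] -/
theorem normMap_apply (ρ : G →* MulAut U) (T : Finset G) (x : U) : normMap ρ T x = ∏ t ∈ T, ρ t x := rfl

/-- On classes modulo torsion the norm is the product of the descended actions:
`[N_T(x)] = ∏_{t ∈ T} ρ̄(t)[x]` in `U^{×μ}`. [cite: Mochizuki2012, Def 4.9 (i) p.154] -/
theorem mk_normMap (ρ : G →* MulAut U) (T : Finset G) (x : U) :
    (QuotientGroup.mk (normMap ρ T x) : ModTorsion U) = ∏ t ∈ T, actionModTorsion ρ t (QuotientGroup.mk x) := by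
  change QuotientGroup.mk' (CommGroup.torsion U) (∏ t ∈ T, ρ t x) = _
  rw [map_prod]
  refine Finset.prod_congr rfl fun t _ => ?_
  rw [QuotientGroup.mk'_apply, actionModTorsion_mk]

/-- The NORM LATTICE of `H` along `T`: the image in `U^{×μ} = U ⧸ U^μ` of `N_T(U^H)` ("the lattice …
determined by the image of `O^×(G)^H`", [IUTchII] Ex. 1.8 (iv) p. 39, pushed forward along the norm).
[claim: Mochizuki2012, status: disputed] (IUTchII §1 Ex 1.8 (iv), kurims p.39) -/
noncomputable def normLattice (ρ : G →* MulAut U) (H : Subgroup G) (T : Finset G) : Subgroup (ModTorsion U) :=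
  ((fixedBy ρ H).map (normMap ρ T)).map (QuotientGroup.mk' (CommGroup.torsion U))

/-- Membership in the norm lattice: classes `[N_T(x)]` with `x ∈ U^H`.
[claim: Mochizuki2012, status: disputed] (IUTchII §1 Ex 1.8 (iv), kurims p.39) -/
theorem mem_normLattice_iff (ρ : G →* MulAut U) (H : Subgroup G) (T : Finset G) (q : ModTorsion U) :
    q ∈ normLattice ρ H T ↔ ∃ x ∈ fixedBy ρ H, QuotientGroup.mk (normMap ρ T x) = q := by
  constructor
  · rintro ⟨_, ⟨x, hx, rfl⟩, rfl⟩
    exact ⟨x, hx, rfl⟩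
  · rintro ⟨x, hx, rfl⟩
    exact ⟨normMap ρ T x, ⟨x, hx, rfl⟩, rfl⟩

/-- With `T = {1}` the norm lattice is the lattice `Im(U^H)` itself (`normMap ρ {1} = id`).
[claim: Mochizuki2012, status: disputed] (IUTchII §1 Ex 1.8 (iv), kurims p.39) -/
theorem normLattice_singleton_one (ρ : G →* MulAut U) (H : Subgroup G) :
    normLattice ρ H {1} = invariantLattice ρ H := by
  ext q
  rw [mem_normLattice_iff]
  constructor
  · rintro ⟨x, hx, rfl⟩
    refine Subgroup.mem_map.mpr ⟨x, hx, ?_⟩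
    simp [normMap_apply]
  · intro hq
    obtain ⟨x, hx, rfl⟩ := Subgroup.mem_map.mp hq
    exact ⟨x, hx, by simp [normMap_apply]⟩

/-! ## Isometries preserve norm lattices -/

/-- An isometry commutes with each descended action, pointwise. [claim: Mochizuki2012, status: disputed] (IUTchII §1 Ex 1.8 (iv), kurims p.39) -/
theorem apply_actionModTorsion_of_mem_isometryGroup {ρ : G →* MulAut U} {𝓗 : Set (Subgroup G)}
    {φ : MulAut (ModTorsion U)} (hφ : φ ∈ isometryGroup ρ 𝓗) (g : G) (q : ModTorsion U) :
    φ (actionModTorsion ρ g q) = actionModTorsion ρ g (φ q) := by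
  have h := congrArg (fun ψ : MulAut (ModTorsion U) => ψ q) ((mem_isometryGroup ρ 𝓗 φ).mp hφ |>.1 g)
  simpa only [MulAut.mul_apply] using h

/-- An isometry carries the class of an `H`-invariant to the class of an `H`-invariant (`H ∈ 𝓗`): the lattice
condition of [IUTchII] Ex. 1.8 (iv), element-wise. [claim: Mochizuki2012, status: disputed] (IUTchII §1 Ex 1.8 (iv), kurims p.39) -/
theorem exists_fixedBy_apply_mk_of_mem_isometryGroup {ρ : G →* MulAut U} {𝓗 : Set (Subgroup G)}
    {φ : MulAut (ModTorsion U)} (hφ : φ ∈ isometryGroup ρ 𝓗) {H : Subgroup G} (hH : H ∈ 𝓗)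
    {x : U} (hx : x ∈ fixedBy ρ H) :
    ∃ x' ∈ fixedBy ρ H, (QuotientGroup.mk x' : ModTorsion U) = φ (QuotientGroup.mk x) := by
  have hlat := ((mem_isometryGroup ρ 𝓗 φ).mp hφ).2 H hH
  have hmem : φ (QuotientGroup.mk x) ∈ invariantLattice ρ H := by
    rw [← hlat]
    exact Subgroup.mem_map.mpr ⟨QuotientGroup.mk x, Subgroup.mem_map.mpr ⟨x, hx, rfl⟩, rfl⟩
  obtain ⟨x', hx', hq⟩ := Subgroup.mem_map.mp hmem
  exact ⟨x', hx', hq⟩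

/-- **An isometry maps each norm lattice INTO itself**: for `φ ∈ Ism`, `H ∈ 𝓗`, any finite `T`,
`φ(Im N_T(U^H)) ⊆ Im N_T(U^H)` — `φ[N_T x] = ∏_t ρ̄(t) φ[x] = ∏_t ρ̄(t)[x'] = [N_T x']` with `x' ∈ U^H`.
[claim: Mochizuki2012, status: disputed] (IUTchII §1 Ex 1.8 (iv), kurims p.39) -/
theorem map_normLattice_le_of_mem_isometryGroup {ρ : G →* MulAut U} {𝓗 : Set (Subgroup G)}
    {φ : MulAut (ModTorsion U)} (hφ : φ ∈ isometryGroup ρ 𝓗) {H : Subgroup G} (hH : H ∈ 𝓗) (T : Finset G) :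
    (normLattice ρ H T).map φ.toMonoidHom ≤ normLattice ρ H T := by
  rintro _ ⟨q, hq, rfl⟩
  obtain ⟨x, hx, rfl⟩ := (mem_normLattice_iff ρ H T q).mp hq
  obtain ⟨x', hx', hx'q⟩ := exists_fixedBy_apply_mk_of_mem_isometryGroup hφ hH hx
  refine (mem_normLattice_iff ρ H T _).mpr ⟨x', hx', ?_⟩
  change QuotientGroup.mk (normMap ρ T x') = φ (QuotientGroup.mk (normMap ρ T x))
  rw [mk_normMap, mk_normMap, map_prod]
  refine Finset.prod_congr rfl fun t _ => ?_
  rw [apply_actionModTorsion_of_mem_isometryGroup hφ, hx'q]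

/-- **NORM RIGIDITY OF ISOMETRIES**: every `φ ∈ Ism = isometryGroup ρ 𝓗` carries the norm lattice
`Im N_T(U^H) ⊆ U^{×μ}` ONTO itself, for every `H ∈ 𝓗` and every finite `T ⊆ G` (apply the inclusion to `φ`
and to `φ⁻¹ ∈ Ism`).  For `U = 𝒪_k̄^×`, `G = G_k`, `H = G_E` (`E/k` finite Galois), `T` = lifts of `Gal(E/k)`:
an isometry of [IUTchII] Ex. 1.8 (iv) preserves `Im(N_{E/k}(𝒪_E^×)) ⊆ Im(𝒪_k^×)`.
[claim: Mochizuki2012, status: disputed] (IUTchII §1 Ex 1.8 (iv), kurims p.39) -/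
theorem map_normLattice_eq_of_mem_isometryGroup {ρ : G →* MulAut U} {𝓗 : Set (Subgroup G)}
    {φ : MulAut (ModTorsion U)} (hφ : φ ∈ isometryGroup ρ 𝓗) {H : Subgroup G} (hH : H ∈ 𝓗) (T : Finset G) :
    (normLattice ρ H T).map φ.toMonoidHom = normLattice ρ H T := by
  refine le_antisymm (map_normLattice_le_of_mem_isometryGroup hφ hH T) fun q hq => ?_
  have hinv : φ⁻¹ ∈ isometryGroup ρ 𝓗 := Subgroup.inv_mem _ hφ
  have hq' : φ⁻¹ q ∈ normLattice ρ H T :=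
    map_normLattice_le_of_mem_isometryGroup hinv hH T (Subgroup.mem_map.mpr ⟨q, hq, rfl⟩)
  refine Subgroup.mem_map.mpr ⟨φ⁻¹ q, hq', ?_⟩
  change φ (φ⁻¹ q) = q
  rw [← MulAut.mul_apply, mul_inv_cancel, MulAut.one_apply]

/-- Element form of norm rigidity: for `φ ∈ Ism`, `H ∈ 𝓗`, `x ∈ U^H`, there is `x' ∈ U^H` with
`φ[N_T(x)] = [N_T(x')]`. [claim: Mochizuki2012, status: disputed] (IUTchII §1 Ex 1.8 (iv), kurims p.39) -/
theorem exists_fixedBy_apply_mk_normMap_of_mem_isometryGroup {ρ : G →* MulAut U} {𝓗 : Set (Subgroup G)}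
    {φ : MulAut (ModTorsion U)} (hφ : φ ∈ isometryGroup ρ 𝓗) {H : Subgroup G} (hH : H ∈ 𝓗) (T : Finset G)
    {x : U} (hx : x ∈ fixedBy ρ H) :
    ∃ x' ∈ fixedBy ρ H, φ (QuotientGroup.mk (normMap ρ T x)) = QuotientGroup.mk (normMap ρ T x') := by
  have h : φ (QuotientGroup.mk (normMap ρ T x)) ∈ normLattice ρ H T := by
    rw [← map_normLattice_eq_of_mem_isometryGroup hφ hH T]
    exact Subgroup.mem_map.mpr ⟨_, (mem_normLattice_iff ρ H T _).mpr ⟨x, hx, rfl⟩, rfl⟩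
  obtain ⟨x', hx', h'⟩ := (mem_normLattice_iff ρ H T _).mp h
  exact ⟨x', hx', h'.symm⟩

/-- … and conversely every `[N_T(x')]`, `x' ∈ U^H`, is `φ[N_T(x)]` for some `x ∈ U^H` (surjectivity onto the
norm lattice). [claim: Mochizuki2012, status: disputed] (IUTchII §1 Ex 1.8 (iv), kurims p.39) -/
theorem exists_fixedBy_mk_normMap_eq_apply_of_mem_isometryGroup {ρ : G →* MulAut U} {𝓗 : Set (Subgroup G)}
    {φ : MulAut (ModTorsion U)} (hφ : φ ∈ isometryGroup ρ 𝓗) {H : Subgroup G} (hH : H ∈ 𝓗) (T : Finset G)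
    {x' : U} (hx' : x' ∈ fixedBy ρ H) :
    ∃ x ∈ fixedBy ρ H, φ (QuotientGroup.mk (normMap ρ T x)) = QuotientGroup.mk (normMap ρ T x') := by
  have h : (QuotientGroup.mk (normMap ρ T x') : ModTorsion U) ∈ (normLattice ρ H T).map φ.toMonoidHom := by
    rw [map_normLattice_eq_of_mem_isometryGroup hφ hH T]
    exact (mem_normLattice_iff ρ H T _).mpr ⟨x', hx', rfl⟩
  obtain ⟨q, hq, hq'⟩ := Subgroup.mem_map.mp h
  obtain ⟨x, hx, rfl⟩ := (mem_normLattice_iff ρ H T q).mp hq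
  exact ⟨x, hx, hq'⟩

/-! ## The inversion is always an isometry (non-vacuity of `Ism` beyond the identity) -/

/-- Inversion `q ↦ q⁻¹` on the commutative group `U^{×μ}`, as an automorphism. [folklore] -/
noncomputable def invAut (U : Type v) [CommGroup U] : MulAut (ModTorsion U) := MulEquiv.inv (ModTorsion U)

/-- `invAut q = q⁻¹` on `U^{×μ}`. [cite: Mochizuki2012, Def 4.9 (i) p.154] -/
@[simp] theorem invAut_apply (q : ModTorsion U) : invAut U q = q⁻¹ := rfl

/-- **`−1 ∈ Ism`**: inversion is `G`-equivariant (the `ρ̄(g)` are homomorphisms) and carries every lattice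
`Im(U^H)` (a subgroup) onto itself — so `Ism` never reduces to the identity (the image of `−1 ∈ Ẑ^×` under
"`Ẑ^× ↠ ℤ_p^× ↪ Ism`", [IUTchII] Ex. 1.8 (iv) p. 39, in the form that needs no `p`-adic structure).
[claim: Mochizuki2012, status: disputed] (IUTchII §1 Ex 1.8 (iv), kurims p.39) -/
theorem invAut_mem_isometryGroup (ρ : G →* MulAut U) (𝓗 : Set (Subgroup G)) : invAut U ∈ isometryGroup ρ 𝓗 := by
  refine (mem_isometryGroup ρ 𝓗 _).mpr ⟨fun g => ?_, fun H _ => ?_⟩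
  · ext q
    simp only [MulAut.mul_apply, invAut_apply, map_inv]
  · apply le_antisymm
    · rintro _ ⟨q, hq, rfl⟩
      exact (invariantLattice ρ H).inv_mem hq
    · intro q hq
      exact Subgroup.mem_map.mpr ⟨q⁻¹, (invariantLattice ρ H).inv_mem hq, by simp⟩

end Literature.IUT.HodgeArakelov
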